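import Summits.AtomisticToContinuum.BoseEinsteinCondensation.Theorems.BECPeriodicReductionBoundaryTransferWeakResidual

/-!
# `BoundaryTransferWeak` (stmt-AtomisticToContinuum-0827) — the MODE-FREE REWARD SPLIT

Supports stmt-AtomisticToContinuum-0827. Landed by lead c4 of the crux (line `rim-squeeze-monotone-coherence`,
route `BECGroundStateSOS`) at the explicit request of the crux strategists (`Cruxes/BoundaryTransferWeak/STRATEGY-CENSUS.md`
rev 3 §6.1 / rev 2 §1 D11: decomposition certified rc 0, axioms propext/Classical.choice/Quot.sound, filing blocked only
because `Theorems/` is prover-only), verbatim the certified crux workfile `Cruxes/BoundaryTransferWeak/Lines/mode_free_reward_split.lean`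
(strategist instance BECIroning), so that a route planner can file the split with
`--glue-by Summit.AtomisticToContinuum.BoseEinsteinCondensation.ModeFreeReward.boundaryTransferWeak_of_modeFreeReward`.
It is a conditional reduction (the two hypotheses are the bodies of the proposed child items X₁, X₂), not a proof of the crux,
and it is independent of the rim-squeeze line (whose own reduction is `Cruxes/…/Lines/rim_squeeze_monotone_coherence_audit.lean`).

Crux-strategist decomposition (BC2 redirect) of the shared per-potential crux `BoundaryTransferWeak`
(torus BEC of the periodic near-minimisers at all small densities ⟹ Dirichlet ground-state BEC
`HasGroundStateBEC v ρ` at all small densities) into two typed pieces and a proved assembly.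

The landed line `reward-pays-the-wall` (p74246–p85115, port p96138) consumes the torus hypothesis exactly once:
`stub_transfer : TorusBECAt v ρ c → RewardedUpperBound v ρ (min c 1)` — the flat-mode rewarded infimum
`F^D(λ) = inf_Ψ [⟨Ψ,HΨ⟩ + λ (N − n_flat(Ψ))]` of the Dirichlet box obeys `F^D(λ) ≤ N (e₀ + θ + λ (1 − c + θ))`.
What is left is the un-rewarding `λ → 0⁺` uniformly in `N`. In FLAT-MODE currency every uniform-in-`N` continuity
statement at `λ = 0⁺` is false already for the free gas (the Dirichlet ground state `∏ sin` is only `(8/π²)³ ≈ 0.533`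
flat; `Negative/RewardedFreeGasAnchors`, `…GapScale`). The split below is therefore MODE-FREE: with

  `G_N(λ) := inf_Ψ [⟨Ψ,HΨ⟩ + λ (N − λ_max(γ_Ψ))]`   (`λ_max = maxOccupation`; an infimum over modes `φ` of the
  ground-state energies of the genuine number-conserving Hamiltonians `H + λ (N − n̂_φ)`; concave in `λ`,
  `G_N(0) = E₀^D`, `G_N ≤ F^D`, and `G_N ≡ E₀^D` for `v = 0` since free product states have `λ_max = N`),

* piece X₁ `ModeFreeRewardChord` (thermodynamic-limit content): for every `τ > 0` some `λ₀ > 0` makes, eventually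
  in `N` and for ALL `0 < λ ≤ λ₀`, the chord slope of `G_N` from `0` to `λ` exceed the one from `0` to `λ₀` by at
  most `τN` (written additively in `ℝ≥0∞`): no first-order jump of the mode-free condensate fraction at reward `0⁺`
  in the thermodynamic limit. It FAILS for the two-state landscape of `Negative/SoftUnrewardingSchema` (so it is not
  a soft consequence of concavity) and HOLDS at `v = 0` (all chords vanish).
* piece X₂ `ModeFreeSlopeToBEC` (fixed-`N` rigidity content): at each large `N`, if `E₀^D < ∞` and
  `G_N(λ) ≤ E₀^D + λ (1 − c) N` for all small `λ`, then `condensateNumber ≥ (c/2) N` (minimising sequences with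
  `λ_max ≥ (c − o(1))N` exist; rigidity of Dirichlet near-minimisers up to phase, stmt-9072, and the `√N`-Lipschitz
  seminorm `√λ_max` transfer it to every near-minimiser).
* ASSEMBLY `boundaryTransferWeak_of_modeFreeReward` (this file, sorry-free): thresholds; the torus hypothesis is spent
  through `stub_transfer`; `G_N(λ₀) ≤ F^D(λ₀) ≤ N(e₀ + θ + λ₀(1 − c₁ + θ))` (flat mode is a mode) and the Dirichlet
  floor `E₀^D ≥ N(e₀ − θ)` (`exists_density_cap_tendsto_e0`) bound the chord at `λ₀`; X₁ with `τ = c₁/8` and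
  `θ = min(λ₀,1) c₁/16` carries it down to every `λ ≤ λ₀`: `G_N(λ) ≤ E₀^D + λ (1 − c₁/2) N`; X₂ turns that into
  `condensateNumber ≥ (c₁/4) N`, i.e. `HasGroundStateBEC v ρ`.

References: LSSY 2005 §1.2 (1.17)–(1.19), Ch. 2 after (2.2), App. D (D.15)–(D.19); Griffiths 1966 §II (convexity in a
source); the tree's `Theorems/BECThomsonPrinciplePeriodicToDirichlet{Defs,Residual}.lean`.
-/

noncomputable section

open MeasureTheory Filter
open scoped ENNReal NNReal Topology

namespace Summit.AtomisticToContinuum.BoseEinsteinCondensation.ModeFreeReward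

open Literature.MathematicalPhysics.QuantumManyBody.BoseGas
open Summit.AtomisticToContinuum.BoseEinsteinCondensation.RewardPaysTheWall

/-! ## The mode-free rewarded infimum is below the flat-mode one -/

/-- **The flat mode is a mode**: the mode-free rewarded infimum
`G_N(λ) = inf_Ψ [⟨Ψ,HΨ⟩ + λ (N − λ_max(γ_Ψ))]` is at most the flat-mode rewarded infimum `rewardedInf v λ N L`
(`n_flat ≤ λ_max` for the normalised measurable flat mode, `L > 0`). [folklore] -/
theorem iInf_modeFree_le_rewardedInf (v : ℝ → ℝ≥0∞) (lam : ℝ) {N : ℕ} {L : ℝ} (hL : 0 < L) :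
    (⨅ Ψ : TrialState N L, energy v Ψ + ENNReal.ofReal lam * ((N : ℝ≥0∞) - maxOccupation N Ψ.ψ)) ≤
      rewardedInf v lam N L := by
  unfold rewardedInf rewardedEnergy
  refine iInf_mono fun Ψ => add_le_add le_rfl (mul_le_mul_right (tsub_le_tsub_left ?_ _) _)
  exact occupation_le_maxOccupation _
    (_root_.AtomisticToContinuum.BECInfraredBound.aestronglyMeasurable_constMode _)
    (_root_.AtomisticToContinuum.BECInfraredBound.lintegral_constMode_sq hL)

/-! ## Chord algebra (real numbers) -/

/-- The real-number heart of the assembly: from the two-chord bound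
`g + r E ≤ E + r g₀ + (c₁/8) λ N` (`r = λ/λ₀`), the rewarded upper bound
`g₀ ≤ N (e + θ + λ₀ (1 − c₁ + θ))` and the floor `N (e − θ) ≤ E`, with `θ ≤ λ₀ c₁/16`, `θ ≤ c₁/16`,
conclude `g ≤ E + λ (1 − c₁/2) N` (indeed `≤ E + λ (1 − 11c₁/16) N`). [folklore] -/
theorem chord_real_bound {g g₀ E e θ lam lam₀ c₁ n : ℝ} (hn : 0 ≤ n) (hlam : 0 < lam)
    (hlam₀ : 0 < lam₀) (hθ : 0 ≤ θ)
    (hθ₁ : θ ≤ lam₀ * c₁ / 16) (hθ₂ : θ ≤ c₁ / 16)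
    (h1 : g + lam / lam₀ * E ≤ E + lam / lam₀ * g₀ + lam * (c₁ / 8) * n)
    (h2 : g₀ ≤ n * (e + θ + lam₀ * (1 - c₁ + θ))) (h3 : n * (e - θ) ≤ E) :
    g ≤ E + lam * (1 - c₁ / 2) * n := by
  have hr : 0 ≤ lam / lam₀ := div_nonneg hlam.le hlam₀.le
  -- `r (g₀ − E) ≤ r n (2θ + λ₀ (1 − c₁ + θ))`
  have h4 : lam / lam₀ * g₀ - lam / lam₀ * E ≤
      lam / lam₀ * (n * (2 * θ + lam₀ * (1 - c₁ + θ))) := by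
    rw [← mul_sub]
    exact mul_le_mul_of_nonneg_left (by nlinarith) hr
  -- `r λ₀ = λ`
  have h5 : lam / lam₀ * lam₀ = lam := div_mul_cancel₀ lam hlam₀.ne'
  -- `r · 2θ ≤ (c₁/8) λ`
  have h6 : lam / lam₀ * (n * (2 * θ)) ≤ lam * (c₁ / 8) * n := by
    have : lam / lam₀ * (2 * θ) ≤ lam * (c₁ / 8) := by
      rw [div_mul_eq_mul_div, div_le_iff₀ hlam₀]
      nlinarith
    nlinarith
  have h7 : lam / lam₀ * (n * (lam₀ * (1 - c₁ + θ))) = lam * n * (1 - c₁ + θ) := by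
    have : lam / lam₀ * (n * (lam₀ * (1 - c₁ + θ))) = (lam / lam₀ * lam₀) * n * (1 - c₁ + θ) := by
      ring
    rw [this, h5]
  have h8 : lam / lam₀ * (n * (2 * θ + lam₀ * (1 - c₁ + θ))) =
      lam / lam₀ * (n * (2 * θ)) + lam / lam₀ * (n * (lam₀ * (1 - c₁ + θ))) := by ring
  nlinarith [mul_nonneg hlam.le hn]

/-! ## The assembly -/

/-- **Per-potential assembly.** For one repulsive finite-range `v`: the mode-free two-chord bound (X₁ at `v`),
the fixed-`N` mode-free slope-to-BEC implication (X₂ at `v`) and torus BEC at all small densities give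
Dirichlet ground-state BEC at all small densities, with constant `min c 1 / 4` below
`min (ρ_A, ρ_transfer, ρ_cap, ρ_X₁, ρ_X₂)`. [folklore] -/
theorem boundaryTransferAt_of_modeFreeReward {v : ℝ → ℝ≥0∞} (hv : IsRepulsiveFiniteRange v)
    (h₁ : ∃ ρ₁ : ℝ, 0 < ρ₁ ∧ ∀ ρ : ℝ, 0 < ρ → ρ < ρ₁ → ∀ τ : ℝ, 0 < τ → ∃ lam₀ : ℝ, 0 < lam₀ ∧
      ∀ᶠ N : ℕ in atTop, ∀ lam : ℝ, 0 < lam → lam ≤ lam₀ →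
        (⨅ Ψ : TrialState N (sideLength ρ N),
            energy v Ψ + ENNReal.ofReal lam * ((N : ℝ≥0∞) - maxOccupation N Ψ.ψ)) +
          ENNReal.ofReal (lam / lam₀) * groundStateEnergy v N (sideLength ρ N) ≤
        groundStateEnergy v N (sideLength ρ N) +
          ENNReal.ofReal (lam / lam₀) *
            (⨅ Ψ : TrialState N (sideLength ρ N),
              energy v Ψ + ENNReal.ofReal lam₀ * ((N : ℝ≥0∞) - maxOccupation N Ψ.ψ)) +
          ENNReal.ofReal (lam * τ * N))
    (h₂ : ∃ ρ₁ : ℝ, 0 < ρ₁ ∧ ∀ ρ : ℝ, 0 < ρ → ρ < ρ₁ → ∀ c : ℝ, 0 < c → c ≤ 1 →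
      ∀ᶠ N : ℕ in atTop, groundStateEnergy v N (sideLength ρ N) ≠ ⊤ →
        (∃ lam₁ : ℝ, 0 < lam₁ ∧ ∀ lam : ℝ, 0 < lam → lam ≤ lam₁ →
          (⨅ Ψ : TrialState N (sideLength ρ N),
              energy v Ψ + ENNReal.ofReal lam * ((N : ℝ≥0∞) - maxOccupation N Ψ.ψ)) ≤
            groundStateEnergy v N (sideLength ρ N) + ENNReal.ofReal (lam * (1 - c) * N)) →
        ENNReal.ofReal (c / 2 * N) ≤ condensateNumber v N (sideLength ρ N))
    (hA : ∃ ρ₀ : ℝ, 0 < ρ₀ ∧ ∀ ρ : ℝ, 0 < ρ → ρ < ρ₀ → ∃ c : ℝ, 0 < c ∧ TorusBECAt v ρ c) :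
    ∃ ρ₀ : ℝ, 0 < ρ₀ ∧ ∀ ρ : ℝ, 0 < ρ → ρ < ρ₀ → HasGroundStateBEC v ρ := by
  obtain ⟨ρA, hρA, HA⟩ := hA
  obtain ⟨ρ₁, hρ₁, H1⟩ := stub_transfer v hv
  obtain ⟨ρ₂, hρ₂, H2⟩ := exists_density_cap_tendsto_e0 v hv
  obtain ⟨ρ₃, hρ₃, H3⟩ := h₁
  obtain ⟨ρ₄, hρ₄, H4⟩ := h₂
  refine ⟨min (min ρA ρ₁) (min ρ₂ (min ρ₃ ρ₄)),
    lt_min (lt_min hρA hρ₁) (lt_min hρ₂ (lt_min hρ₃ hρ₄)), fun ρ hρ hlt => ?_⟩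
  have hltA : ρ < ρA := hlt.trans_le ((min_le_left _ _).trans (min_le_left _ _))
  have hlt₁ : ρ < ρ₁ := hlt.trans_le ((min_le_left _ _).trans (min_le_right _ _))
  have hlt₂ : ρ < ρ₂ := hlt.trans_le ((min_le_right _ _).trans (min_le_left _ _))
  have hlt₃ : ρ < ρ₃ :=
    hlt.trans_le ((min_le_right _ _).trans ((min_le_right _ _).trans (min_le_left _ _)))
  have hlt₄ : ρ < ρ₄ :=
    hlt.trans_le ((min_le_right _ _).trans ((min_le_right _ _).trans (min_le_right _ _)))
  -- the torus hypothesis, spent once through the landed transfer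
  obtain ⟨c, hc, hT⟩ := HA ρ hρ hltA
  set c₁ : ℝ := min c 1 with hc₁def
  have hc₁ : 0 < c₁ := lt_min hc one_pos
  have hc₁1 : c₁ ≤ 1 := min_le_right c 1
  have hU : RewardedUpperBound v ρ c₁ := H1 ρ hρ hlt₁ c hc hT
  -- the dilute thermodynamic limit: `e₀ < ∞`, `E₀^D/N → e₀`
  obtain ⟨he, hTD, -⟩ := H2 ρ hρ hlt₂
  -- X₁ with `τ = c₁/8`
  obtain ⟨lam₀, hlam₀, hX1⟩ := H3 ρ hρ hlt₃ (c₁ / 8) (by positivity)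
  -- `θ = min(λ₀, 1) c₁ / 16`
  set θ : ℝ := min lam₀ 1 * c₁ / 16 with hθdef
  have hθ : 0 < θ := by
    rw [hθdef]; exact div_pos (mul_pos (lt_min hlam₀ one_pos) hc₁) (by norm_num)
  have hθ₁ : θ ≤ lam₀ * c₁ / 16 := by
    rw [hθdef]
    exact div_le_div_of_nonneg_right (mul_le_mul_of_nonneg_right (min_le_left _ _) hc₁.le)
      (by norm_num)
  have hθ₂ : θ ≤ c₁ / 16 := by
    rw [hθdef]
    have : min lam₀ 1 * c₁ ≤ 1 * c₁ := mul_le_mul_of_nonneg_right (min_le_right _ _) hc₁.le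
    rw [one_mul] at this
    exact div_le_div_of_nonneg_right this (by norm_num)
  -- rewarded upper bound at `(θ, λ₀)`, floor and ceiling of `E₀^D`, X₂ with `c = c₁/2`
  have hUN := hU θ hθ lam₀ hlam₀.le
  have hfl := eventually_mul_sub_le_toReal_of_groundStateEnergy_le he hTD hθ
  have hceil := eventually_groundStateEnergy_le_of_tendsto he hTD one_pos
  have hX2 := H4 ρ hρ hlt₄ (c₁ / 2) (by positivity) (by linarith)
  refine ⟨c₁ / 2 / 2, by positivity, ?_⟩
  filter_upwards [hX1, hUN, hfl, hceil, hX2, eventually_gt_atTop 0] with N hN1 hN2 hN3 hN4 hN5 hNpos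
  -- abbreviations at this `N`
  set L : ℝ := sideLength ρ N with hLdef
  have hL : 0 < L := by
    rw [hLdef]
    unfold sideLength
    exact Real.rpow_pos_of_pos (div_pos (Nat.cast_pos.mpr hNpos) hρ) _
  set E₀ : ℝ≥0∞ := groundStateEnergy v N L with hE₀def
  have hE₀top : E₀ ≠ ⊤ := ne_top_of_le_ne_top ENNReal.ofReal_ne_top hN4
  have hNr : (0 : ℝ) ≤ N := N.cast_nonneg
  -- the chord at `λ₀`: `G(λ₀) ≤ F^D(λ₀) ≤ N (e + θ + λ₀ (1 − c₁ + θ))`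
  set G₀ : ℝ≥0∞ := ⨅ Ψ : TrialState N L,
      energy v Ψ + ENNReal.ofReal lam₀ * ((N : ℝ≥0∞) - maxOccupation N Ψ.ψ) with hG₀def
  have hA₀ : 0 ≤ (N : ℝ) * ((e0 v ρ).toReal + θ + lam₀ * (1 - c₁ + θ)) := by
    have : 0 ≤ lam₀ * (1 - c₁ + θ) := mul_nonneg hlam₀.le (by linarith)
    positivity
  have hG₀le : G₀ ≤ ENNReal.ofReal ((N : ℝ) * ((e0 v ρ).toReal + θ + lam₀ * (1 - c₁ + θ))) :=
    (iInf_modeFree_le_rewardedInf v lam₀ hL).trans hN2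
  have hG₀top : G₀ ≠ ⊤ := ne_top_of_le_ne_top ENNReal.ofReal_ne_top hG₀le
  -- the floor
  have hfloor : (N : ℝ) * ((e0 v ρ).toReal - θ) ≤ E₀.toReal := hN3 _ le_rfl hE₀top
  -- KEY: `G(λ) ≤ E₀ + λ (1 − c₁/2) N` for all `0 < λ ≤ λ₀`
  have key : ∀ lam : ℝ, 0 < lam → lam ≤ lam₀ →
      (⨅ Ψ : TrialState N L, energy v Ψ + ENNReal.ofReal lam * ((N : ℝ≥0∞) - maxOccupation N Ψ.ψ)) ≤
        E₀ + ENNReal.ofReal (lam * (1 - c₁ / 2) * N) := by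
    intro lam hlam hle
    set G : ℝ≥0∞ := ⨅ Ψ : TrialState N L,
      energy v Ψ + ENNReal.ofReal lam * ((N : ℝ≥0∞) - maxOccupation N Ψ.ψ) with hGdef
    have hX : G + ENNReal.ofReal (lam / lam₀) * E₀ ≤
        E₀ + ENNReal.ofReal (lam / lam₀) * G₀ + ENNReal.ofReal (lam * (c₁ / 8) * N) := hN1 lam hlam hle
    -- finiteness of `G`
    have hRtop : E₀ + ENNReal.ofReal (lam / lam₀) * G₀ + ENNReal.ofReal (lam * (c₁ / 8) * N) ≠ ⊤ :=
      ENNReal.add_ne_top.2 ⟨ENNReal.add_ne_top.2 ⟨hE₀top, ENNReal.mul_ne_top ENNReal.ofReal_ne_top hG₀top⟩,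
        ENNReal.ofReal_ne_top⟩
    have hGtop : G ≠ ⊤ := ne_top_of_le_ne_top hRtop (le_self_add.trans hX)
    -- pass to real numbers
    have hr : 0 ≤ lam / lam₀ := div_nonneg hlam.le hlam₀.le
    have hcN : 0 ≤ lam * (c₁ / 8) * N := by positivity
    have hX' : G.toReal + lam / lam₀ * E₀.toReal ≤
        E₀.toReal + lam / lam₀ * G₀.toReal + lam * (c₁ / 8) * N := by
      have h := ENNReal.toReal_mono hRtop hX
      rw [ENNReal.toReal_add hGtop (ENNReal.mul_ne_top ENNReal.ofReal_ne_top hE₀top),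
        ENNReal.toReal_add (ENNReal.add_ne_top.2 ⟨hE₀top, ENNReal.mul_ne_top ENNReal.ofReal_ne_top hG₀top⟩)
          ENNReal.ofReal_ne_top,
        ENNReal.toReal_add hE₀top (ENNReal.mul_ne_top ENNReal.ofReal_ne_top hG₀top),
        ENNReal.toReal_mul, ENNReal.toReal_mul, ENNReal.toReal_ofReal hr, ENNReal.toReal_ofReal hcN] at h
      exact h
    have hG₀' : G₀.toReal ≤ (N : ℝ) * ((e0 v ρ).toReal + θ + lam₀ * (1 - c₁ + θ)) := by
      have h := ENNReal.toReal_mono ENNReal.ofReal_ne_top hG₀le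
      rwa [ENNReal.toReal_ofReal hA₀] at h
    have hreal : G.toReal ≤ E₀.toReal + lam * (1 - c₁ / 2) * N :=
      chord_real_bound hNr hlam hlam₀ hθ.le hθ₁ hθ₂ hX' hG₀' hfloor
    have h1c : 0 ≤ lam * (1 - c₁ / 2) * N := by
      have : 0 ≤ 1 - c₁ / 2 := by linarith
      positivity
    calc G = ENNReal.ofReal G.toReal := (ENNReal.ofReal_toReal hGtop).symm
      _ ≤ ENNReal.ofReal (E₀.toReal + lam * (1 - c₁ / 2) * N) := ENNReal.ofReal_le_ofReal hreal
      _ = ENNReal.ofReal E₀.toReal + ENNReal.ofReal (lam * (1 - c₁ / 2) * N) :=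
          ENNReal.ofReal_add ENNReal.toReal_nonneg h1c
      _ = E₀ + ENNReal.ofReal (lam * (1 - c₁ / 2) * N) := by rw [ENNReal.ofReal_toReal hE₀top]
  -- X₂ at this `N`
  exact hN5 hE₀top ⟨lam₀, hlam₀, key⟩

/-- **`BoundaryTransferWeak` (stmt-0827) from the two mode-free reward pieces** — the glue of the split
`ModeFreeRewardChord → ModeFreeSlopeToBEC → BoundaryTransferWeak` (hypotheses spelled out; they are verbatim the
bodies of the two child items). [folklore] -/
theorem boundaryTransferWeak_of_modeFreeReward : (∀ v : ℝ → ℝ≥0∞, IsRepulsiveFiniteRange v → ∃ ρ₁ : ℝ, 0 < ρ₁ ∧ ∀ ρ : ℝ, 0 < ρ → ρ < ρ₁ → ∀ τ : ℝ, 0 < τ → ∃ lam₀ : ℝ, 0 < lam₀ ∧ ∀ᶠ N : ℕ in atTop, ∀ lam : ℝ, 0 < lam → lam ≤ lam₀ → (⨅ Ψ : TrialState N (sideLength ρ N), energy v Ψ + ENNReal.ofReal lam * ((N : ℝ≥0∞) - maxOccupation N Ψ.ψ)) + ENNReal.ofReal (lam / lam₀) * groundStateEnergy v N (sideLength ρ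 N) ≤ groundStateEnergy v N (sideLength ρ N) + ENNReal.ofReal (lam / lam₀) * (⨅ Ψ : TrialState N (sideLength ρ N), energy v Ψ + ENNReal.ofReal lam₀ * ((N : ℝ≥0∞) - maxOccupation N Ψ.ψ)) + ENNReal.ofReal (lam * τ * N)) → (∀ v : ℝ → ℝ≥0∞, IsRepulsiveFiniteRange v → ∃ ρ₁ : ℝ, 0 < ρ₁ ∧ ∀ ρ : ℝ, 0 < ρ → ρ < ρ₁ → ∀ c : ℝ, 0 < c → c ≤ 1 → ∀ᶠ N : ℕ in atTop, groundStateEnergy v N (sideLength ρ N) ≠ ⊤ → (∃ lam₁ : ℝ, 0 < lam₁ ∧ ∀ lam : ℝ, 0 < lam → lam ≤ lam₁ → (⨅ Ψ : TrialState N (sideLength ρ N), energy v Ψ + ENNReal.ofReal lam * ((N : ℝ≥0∞) - maxOccupation N Ψ.ψ)) ≤ groundStateEnergy v N (sideLength ρ N) + ENNReal.ofReal (lam * (1 - c) * N)) → ENNReal.ofReal (c / 2 * N) ≤ condensateNumber v N (sideLength ρ N)) → Summit.AtomisticToContinuum.BoseEinsteinCondensation.Theses.BECPeriodicReduction.BoundaryTransferWeak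 :=
  fun h₁ h₂ v hv hA => boundaryTransferAt_of_modeFreeReward hv (h₁ v hv) (h₂ v hv) hA

end Summit.AtomisticToContinuum.BoseEinsteinCondensation.ModeFreeReward

end
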